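import Summits.BirchSwinnertonDyer.BirchSwinnertonDyer.Theorems.ByReductionTypeAtTwoOrdKatoHalfAtTwoIsoOmegaRoadDefs
import Summits.BirchSwinnertonDyer.BirchSwinnertonDyer.Theorems.ByReductionTypeAtTwoOrdKatoHalfAtTwoIsoSelmerSideTwo
import Summits.BirchSwinnertonDyer.BirchSwinnertonDyer.Theorems.ByReductionTypeAtTwoOrdKatoHalfAtTwoIsoChebotarevTranspositionSignFree
import HarnessLib

/-!
# Route ByReductionTypeAtTwo, crux `OrdKatoHalfAtTwoIso` (stmt-BirchSwinnertonDyer-19573), child B8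
# `OrdKatoIntSurjectiveAtTwo` (stmt-BirchSwinnertonDyer-23762): SOCKET 1 (the core Theorem A at `2`) WITHOUT `Δ < 0`
# from (H-K) WITHOUT `Δ < 0` — T1 and the sign-free (H-C) being theorems

Seat `cruxlead-stmt-BirchSwinnertonDyer-19573-w2` (prover WIDTH under the LEAD cruxlead-19573 g4, line
`steinberg-fibre-at-two`; HOME `run/shared/lean/pub/bsd-2adic/`; `--supports` stmt-BirchSwinnertonDyer-23762). HONEST FRAMING
(cell bsd-2adic): BSD is not proved by any of this; neither the crux nor the child B8 is proved here; ONE theorem, whose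
hypothesis `hK` (the statement `KolyvaginRankOneTwo` of `…OmegaRoadDefs` §3 with its binder `W.Δ < 0` deleted) is an
OPEN reading written INLINE (no definition, no named fact, no `sorry`); nothing is asserted about `hK`.

WHY. The registered socket 1 `CoreTheoremATwoResidue` (p655368; PROVED on `Δ < 0` as `coreTheoremATwoResidue_holds`,
p669276) is composed (`stub_port_of_rankOne`, p658966) from T1 `SelmerSideTwo` (sign-free, PROVED p663770), Ω1 = (H-C)
`ChebotarevTranspositionTwo` and Ω2 = (H-K) `KolyvaginRankOneTwo`, the last two stated with `Δ < 0`. This seat proved (H-C)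
WITHOUT the sign for the cyclotomic tower at a good `2` (p681540 `chebotarevTransposition_two_of_good_two`, from p681344: a
transposition of `E[2]` in `ker κ` exists for `κ` cyclotomic when `2Δ ∉ ℚ^{×2}`). Hence socket 1 without `Δ < 0` — what
the B8 chain needs on `0 < Δ` (next file `…KatoIntSignFreeDoor`) — follows from (H-K) without `Δ < 0` ALONE; the `Δ < 0`
of (H-K) serves only the real place in Step 4 (`H¹(ℝ, 𝒯_J(E)) = 0` iff complex conjugation is odd on `E[2]` iff `Δ < 0`;
p662576), i.e. the kernel locus of MEMO-6's archimedean factor `c_∞ = 2`.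

References: B. Mazur, K. Rubin, Mem. AMS 799 (2004) Prop. 1.3.2, §§3, 5.3 [MazurRubin2004]; K. Kato, Astérisque 295 (2004)
§13.8 [Kato2004Asterisque]; J. S. Milne, *Arithmetic Duality Theorems* (2006) I Thm. 4.10 [MilneADT2006]; the line's
files p658966, p663770, p669276, p681344, p681540.
-/

set_option autoImplicit false
set_option linter.dupNamespace false

noncomputable section

open scoped Classical NumberField
open WeierstrassCurve Field IsDedekindDomain NumberField
open Literature.NumberTheory.GaloisRepresentations
open Literature.NumberTheory.GaloisCohomology
open Literature.NumberTheory.EllipticCurves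
open Literature.NumberTheory.EllipticCurves.Kato2004
open Literature.NumberTheory.EllipticCurves.Kato2004.EulerSystemValues
open Summit.BirchSwinnertonDyer.BirchSwinnertonDyer.Rank1Residual
open Summit.BirchSwinnertonDyer.BirchSwinnertonDyer.Rank1Residual.CoreAssembly

namespace Summit.BirchSwinnertonDyer.BirchSwinnertonDyer.Theorems.SteinbergFibreAtTwo

/-! ## §1 Socket 1 WITHOUT `Δ < 0` from (H-K) WITHOUT `Δ < 0` (T1 and the sign-free H-C are theorems) -/

/-- **The core Theorem A at `2` without the sign hypothesis, from (H-K) without the sign hypothesis (KERNEL).** For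
every globally minimal `W`, good ordinary at `2`, `ρ̄_{W,2}` onto, the CYCLOTOMIC `(κ, γ)` and a pinned `𝐇¹`: a genuine
`2`-adic Euler-system class `∉ 2𝐇¹` kills the `E[2]`-lifts of `Sel₀(E/ℚ_∞)` by a power of `T` — GRANTED the displayed
hypothesis `hK` = the statement `KolyvaginRankOneTwo` (`…OmegaRoadDefs` §3) with its binder `W.Δ < 0` deleted (Kolyvagin's
class of one transposition prime and the reciprocity law at `2` incl. the REAL place; OPEN, the kernel locus of MEMO-6's
`c_∞ = 2`; nothing asserted about it). Proof = the Ω-road composition `coreTwoResidue_of_rankOne` (p658966) with T1 =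
`stub_T1_selmerSideTwo` (p663770), the sign-free H-C `chebotarevTransposition_two_of_good_two` (p681540: complex
conjugation replaced by a transposition in `ker κ`, which exists for `κ` cyclotomic at a good `2`), Kato §13.8 on the pin
and Poitou–Tate over `ℚ` (both PROVED at `2`), and the count `convCoeff_zero_one_eq_zero_of_reciprocity`.
[cite: MazurRubin2004, Prop. 1.3.2 and §5.3] [cite: Kato2004Asterisque, §13.8 (pp. 228–229)] -/
theorem coreTheoremATwo_signFree_of_kolyvagin_signFree
    (hK : ∀ (W : WeierstrassCurve ℚ) [W.IsElliptic] [W.IsGloballyMinimal]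
      [ContinuousSMul ℤ_[2] (W.tateModule 2)] [Module.Free ℤ_[2] (W.tateModule 2)]
      [Module.Finite ℤ_[2] (W.tateModule 2)]
      (κ : ZpExtension ℚ 2) (γ : absoluteGaloisGroup ℚ) (I : IwasawaH1Data W 2 κ γ) (hκ : κ.IsCyclotomic),
      W.HasSurjectiveModNGaloisRep 2 → κ.IsTopGenerator γ →
      poitouTate_sum_localTatePairing_eq_zero ℚ →
      ∀ (s : I.H), IsEulerSystemClassTwo W hκ I s →
      ∃ (S₀ : Set (HeightOneSpectrum (𝓞 ℚ))), S₀.Finite ∧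
        ∀ (a : ℕ) (κ' : κ.twistTower (W.torsionGaloisModule (2 : ℤ))
            (fun P : WeierstrassCurve.geomTorsion W (2 : ℤ) => AddSubgroup.torsionBy.nsmul P)),
          (κ.towerShift (W.torsionGaloisModule (2 : ℤ))
              (fun P : WeierstrassCurve.geomTorsion W (2 : ℤ) => AddSubgroup.torsionBy.nsmul P))^[a]
            κ' = I.redTower s →
          ∀ (J n : ℕ), J ≤ 2 ^ n →
          ∀ (Φ : contOneCocycles (W.modPTwist 2 κ J).toTopRep),
            oneCocycleClass (W.modPTwist 2 κ J).toTopRep Φ = κ'.1 J →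
          ∀ (ε : ℕ) (S₁ : Set (HeightOneSpectrum (𝓞 ℚ)))
            (Ψ : galoisCohomology (W.modPTwist 2 κ.invTwist J) 1)
            (Ψc : contOneCocycles (W.modPTwist 2 κ.invTwist J).toTopRep),
            S₀ ⊆ S₁ →
            oneCocycleClass (W.modPTwist 2 κ.invTwist J).toTopRep Ψc = Ψ →
            (∀ v : HeightOneSpectrum (𝓞 ℚ), v ∉ S₁ →
              galoisCohomology.localization (W.modPTwist 2 κ.invTwist J) (Sum.inr v) 1 Ψ ∈
                DiscreteGaloisModule.unramifiedSubgroup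
                  (GaloisRep.toLocal v (W.modPTwist 2 κ.invTwist J)) 1) →
            (∀ v : HeightOneSpectrum (𝓞 ℚ), v ∈ S₁ →
              galoisCohomology.localization (W.modPTwist 2 κ.invTwist J) (Sum.inr v) 1
                ((κ.invTwist.shiftH1 (W.torsionGaloisModule (2 : ℤ))
                  (fun P : WeierstrassCurve.geomTorsion W (2 : ℤ) => AddSubgroup.torsionBy.nsmul P)
                  J)^[ε] Ψ) = 0) →
          ∀ (eW : WeierstrassCurve.geomTorsion W (2 : ℤ) → WeierstrassCurve.geomTorsion W (2 : ℤ) →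
              AlgebraicClosure ℚ)
            (hμ : ∀ S T, eW S T ^ 2 = 1)
            (hadd₁ : ∀ S₁' S₂' T, eW (S₁' + S₂') T = eW S₁' T * eW S₂' T)
            (hadd₂ : ∀ S T₁ T₂, eW S (T₁ + T₂) = eW S T₁ * eW S T₂),
            (∀ T, eW T T = 1) → (∀ T, (∀ S, eW S T = 1) → T = 0) →
            (∀ (σ : absoluteGaloisGroup ℚ) (S T : WeierstrassCurve.geomTorsion W (2 : ℤ)),
              σ • eW S T = eW (σ • S) (σ • T)) →
          ∀ (q : HeightOneSpectrum (𝓞 ℚ)), q ∉ S₁ →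
          ∀ 𝔓 ∈ q.primesAbove, ∀ (Fr : absoluteGaloisGroup ℚ), IsArithFrobAt (𝓞 ℚ) Fr 𝔓 →
            WeierstrassCurve.galoisRepTorsion W 2 Fr ≠ 1 → WeierstrassCurve.galoisRepTorsion W 2 (Fr * Fr) = 1 →
            Fr ∈ κ.layerSubgroup n →
          ∃ U : Polynomial ℤ, ¬ (((2 : ℕ) : ℤ) ∣ U.coeff 0) ∧
            ∀ i : ℕ, i + ε < J →
              convCoeff (weilPairingHom W 2 eW hμ hadd₁ hadd₂) J i
                (Polynomial.aeval (shiftEnd (WeierstrassCurve.geomTorsion W (2 : ℤ)) J) U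
                  ((shiftEnd (WeierstrassCurve.geomTorsion W (2 : ℤ)) J ^ a)
                    (W.modPTwist 2 κ J Fr (Φ.1 Fr) - Φ.1 Fr)))
                (Ψc.1 Fr) = 0) :
    ∀ (W : WeierstrassCurve ℚ) [W.IsElliptic] [W.IsGloballyMinimal]
      [ContinuousSMul ℤ_[2] (W.tateModule 2)] [Module.Free ℤ_[2] (W.tateModule 2)]
      [Module.Finite ℤ_[2] (W.tateModule 2)]
      (κ : ZpExtension ℚ 2) (γ : absoluteGaloisGroup ℚ) (I : IwasawaH1Data W 2 κ γ)
      (hκ : κ.IsCyclotomic),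
      W.HasGoodReductionAtPrime 2 → ¬ (2 : ℤ) ∣ W.frobeniusTrace 2 →
      W.HasSurjectiveModNGaloisRep 2 → κ.IsTopGenerator γ →
      (∃ s : I.H, IsEulerSystemClassTwo W hκ I s ∧
        s ∉ IwasawaAlgebra.augIdealP 2 • (⊤ : Submodule (IwasawaAlgebra 2) I.H)) →
      ∃ J : ℕ, ∀ y : Literature.NumberTheory.EllipticCurves.subgroupH1 κ.kerSubgroup
          (WeierstrassCurve.geomTorsion W (2 : ℤ)),
        W.torsionToPrimaryH1Sub 2 κ.kerSubgroup y ∈ W.fineSelmerInfty κ →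
          (⇑(Literature.NumberTheory.EllipticCurves.conjH1 κ.kerSubgroup
              (WeierstrassCurve.geomTorsion W (2 : ℤ)) γ -
            AddMonoidHom.id (Literature.NumberTheory.EllipticCurves.subgroupH1 κ.kerSubgroup
              (WeierstrassCurve.geomTorsion W (2 : ℤ)))))^[J] y = 0 := by
  intro W _ _ _ _ _ κ γ I hκ hgood _ h2 hγ hs
  have hred : mem_pSmul_of_red_eq_zero := mem_pSmul_of_red_eq_zero_holds
  have hPT : poitouTate_sum_localTatePairing_eq_zero ℚ := poitouTate_sum_localTatePairing_eq_zero_holds ℚ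
  obtain ⟨s, hES, hsp⟩ := hs
  have hirr : W.HasIrreducibleModPGaloisRep 2 := hasIrreducibleModPGaloisRep_of_hasSurjectiveModNGaloisRep W 2 h2
  -- STEP 0 (tree, any prime): `red_Ω s = T^a κ'`, `κ̄' ≠ 0`
  have ht : I.redTower s ≠ 0 := I.redTower_ne_zero_of_not_mem hred hκ hγ hsp
  obtain ⟨a, κ', hκ'a, -, hκ'c⟩ :=
    LevelE.exists_towerShift_iterate_eq_and_towerConst_ne_zero W 2 κ hirr ht
  -- Steps 3–4 (H-K, sign-free, DISPLAYED): the bad set `S₀`; the Selmer side T1 (PROVED): `ε`, `S₁ ⊇ S₀`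
  obtain ⟨S₀, hS₀, hK'⟩ := hK W κ γ I hκ h2 hγ hPT s hES
  obtain ⟨ε, S₁, hS₁, hS₀₁, hG1'⟩ := stub_T1_selmerSideTwo W κ γ h2 hκ hγ S₀ hS₀
  -- a Weil pairing on `E[2]`
  obtain ⟨eW, hμ, hadd₁, hadd₂, halt, hnondeg, hgal⟩ := W.exists_weilPairing_holds 2 le_rfl (by norm_num)
  -- suppose the conclusion fails; level `J = e + 1 = a + ε + 2`, depth `n := e + 1` (`J ≤ 2^n`)
  by_contra hcon
  push Not at hcon
  set e : ℕ := a + ε + 1 with he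
  have hJn : e + 1 ≤ 2 ^ (e + 1) := (Nat.lt_pow_self (by norm_num)).le
  obtain ⟨y, hy, hyT⟩ := hcon e
  obtain ⟨Ψ, hΨT, hΨur, hΨε⟩ := hG1' e y hy hyT
  obtain ⟨Ψc, hΨc⟩ := oneCocycleClass_surjective _ Ψ
  subst hΨc
  obtain ⟨Φ, hΦ⟩ := oneCocycleClass_surjective _ (κ'.1 (e + 1))
  -- STEPS 1+2 (H-C, sign-free, PROVED p681540): a transposition prime `q ∉ S₁` of depth `≥ e + 1`
  obtain ⟨q, hq, 𝔓, h𝔓, Fr, hFr, hFr1, hFr2, hFrn, hne⟩ :=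
    chebotarevTransposition_two_of_good_two W κ γ h2 hgood hκ hγ κ' hκ'c e Φ hΦ Ψc hΨT eW hμ hadd₁ hadd₂ halt
      hnondeg hgal S₁ hS₁ (e + 1)
  -- STEPS 3–4 (H-K): the Kolyvagin class of `q` and reciprocity
  obtain ⟨U, hU0, hrec⟩ := hK' a κ' hκ'a (e + 1) (e + 1) hJn Φ hΦ ε S₁ _ Ψc hS₀₁ rfl hΨur hΨε eW hμ hadd₁
    hadd₂ halt hnondeg hgal q hq 𝔓 h𝔓 Fr hFr hFr1 hFr2 hFrn
  -- the count (tree): `C_0 = 0` for the pair `(N Φ(Fr), Ψc(Fr))`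
  have hpC : ∀ c : DiscreteGaloisModule.MuCarrier ℚ 2, ((2 : ℕ) : ℤ) • c = 0 :=
    natCast_zsmul_muCarrier_eq_zero ℚ 2
  obtain ⟨hC0, -⟩ := convCoeff_zero_one_eq_zero_of_reciprocity (weilPairingHom W 2 eW hμ hadd₁ hadd₂)
    Nat.prime_two hpC (m := a) (ε := ε) (by omega) U hU0 _ (Ψc.1 Fr) hrec
  rw [convCoeff_zero_eq _ (by omega), Pi.sub_apply, modPTwist_apply_zero] at hC0
  exact hne hC0

end Summit.BirchSwinnertonDyer.BirchSwinnertonDyer.Theorems.SteinbergFibreAtTwo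

end
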